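import Summits.BirchSwinnertonDyer.Rank1Residual.Additive.KummerDeuringModelExplicit
import Summits.BirchSwinnertonDyer.Rank1Residual.Additive.GoodModelReductionKernel
import Literature.NumberTheory.GaloisRepresentations.ModNCyclotomicCharacter
import Mathlib.NumberTheory.GaussSum
import HarnessLib

/-!
# The reduced automorphism `[−1]` of a good model, and the SIGN of `σ^{e/2}` on the Kummer element:
# `σ^{e/2}(u) = (χ̄_p(σ) / p) · u` for inertial `σ`, `u^e = p^m`, `e` even, `m` odd
# (cell `b2b-bsdres`, team n1011, seat p16 (gen 7); row T-QEXP FILE Q2 — the two local inputs of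
# the (P-e46-odd) producer `Additive/RamifiedOrdinaryLineHalfPower.lean`)

HONEST FRAMING (cell `b2b-bsdres`, run/shared/lean/b2b/bsd-rank1-residual/, verbatim in every
file): the goal of the cell is to DELETE the COMBINATION-SHAPED residual classes of the
Birch–Swinnerton-Dyer formula for ALL analytic-rank `≤ 1` elliptic curves over `ℚ` — "full BSD
formula for every rank `≤ 1` curve in class `C`" assembled STRICTLY from published theorems — so
that the rank-`≤ 1` remainder becomes exactly the CONSTRUCTION-SHAPED classes, which are TYPED
(missing-input `Prop`s), NOT attempted. This is not "finishing BSD". Team n1011 (N10/N11): research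
route on the CONSTRUCTION-SHAPED classes X3♯(G-ord)/X4♯(G-ord); prove what is provable now; no
claim beyond stated classes; census output = EVIDENCE, never a Literature fact; RESIDUAL-MAP marks
UNCHANGED; nothing is booked by this file. TOOL theorems only: NO definition, NO named fact, NO
conjecture node.

## What and why

The quotient character `ψ₂ : I_v → Aut(E[p^∞]/C)` of the ramified ordinary line of a (G-ord) row is
the action of inertia on the reduction `W̃₀` of a good model `W₀ = C • E ⊗ K̄_v` through reduced
changes of variables (Serre–Tate 1968 §2; the tree's `InertiaReductionAutomorphismProofs`). On p07's
Kummer–Deuring model (Q1 `exists_kummerGoodModel_explicit`: `C = ⟨u, r, s, t⟩`, `r, s, t ∈ ℚ`,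
`u^e = p^m`, SHORT `W₀`) the element `σ^{e/2}` of an inertial `σ` multiplies `u` by the sign
`ε = ζ_σ^{e/2} = ±1`, so `σ^{e/2}(C) = ⟨ε, 0, 0, 0⟩ · C` and its reduced change of variables is
`[ε] = ±id`. This file supplies the two local inputs of the (P-e46-odd) producer:

* §1 (valued-field level, the `[−1]` twin of p05's F-A1 `goodReductionHom_pointEquiv_map_eq_of_map_eq`)
  **`goodReductionHom_pointEquiv_map_eq_neg_of_map_eq`**: if an inertial isometry `σ` satisfies
  `σ(C) = ⟨−1, 0, 0, 0⟩ · C` on a short good model, then `red(Φ_C(P^σ)) = − red(Φ_C(P))`;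
* §2 **`exists_gaussSum_algebraicClosure`**: for any field `K` with `p ≠ 0` in `K`, `p` odd, a Gauss
  sum `s ∈ K̄`, `s² = (−1/p)·p`, on which `Γ_K` acts through the Legendre symbol of the mod `p`
  cyclotomic character (the tree's `Rat.exists_gaussSum`, base field generalised; Mathlib
  `gaussSum_sq`, `gaussSum_mulShift`);
* §3 **`pow_div_two_smul_eq_legendre_mul`**: for `σ` in the local inertia group at `v ∋ p`,
  `u^e = p^m` with `e` even, `p ∤ e`, `m` odd: `σ^{e/2}(u) = (χ̄_p(σ)/p) · u` — `u^{e/2} = i · s^m`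
  with `i^4 = 1` fixed by inertia (A1 `eq_one_of_pow_eq_one_of_specVal_sub_one_lt`), `m` odd.

References: J.-P. Serre, J. Tate, Ann. of Math. 88 (1968) §2 Thm. 2 [SerreTate1968]; J. H.
Silverman, *AEC* 2nd ed. VII.1.3(d), VII.2.1 [SilvermanAEC2009]; K. Ireland, M. Rosen, *A Classical
Introduction to Modern Number Theory*, GTM 84, §6.3 Thm. 1 (the sign of the Gauss sum's square);
cells/n1011/skel/T-QEXP.md (9035fb2cb670ba82).
-/

set_option autoImplicit false

noncomputable section

open scoped Classical NNReal NumberField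

open WeierstrassCurve

universe u

namespace Summit.BirchSwinnertonDyer.Rank1Residual.Additive.GoodModelLine

open Literature.NumberTheory.EllipticCurves

/-! ## §1 The reduced automorphism `[−1]`: an inertial isometry with `σ(C) = ⟨−1,0,0,0⟩·C` negates reductions -/

section Valued

variable {L : Type u} [Field L] {w : Valuation L ℝ≥0} {F : Type*} [Field F] [Algebra F L]

/-- `⟨−1, 0, 0, 0⟩.toX = id`. [folklore] -/
theorem toX_negOne (x : L) : (⟨-1, 0, 0, 0⟩ : VariableChange L).toX x = x := by
  rw [VariableChange.toX_def]
  simp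

/-- `⟨−1, 0, 0, 0⟩.toY x y = −y`. [folklore] -/
theorem toY_negOne (x y : L) : (⟨-1, 0, 0, 0⟩ : VariableChange L).toY x y = -y := by
  rw [VariableChange.toY_def]
  have h : (((-1 : Lˣ)⁻¹ : Lˣ) : L) = -1 := by simp
  rw [h]
  ring

/-- **An inertial isometry acting on the change of variables of a SHORT good model by `[−1]`
NEGATES reductions.** In the setting of F-A1 `goodReductionHom_pointEquiv_map_eq_of_map_eq`
(`W' = C • X_L = W₀ ⊗ L` a `w`-integral model with unit discriminant of the base change of `X/F`,
`σ ∈ Aut(L/F)` an isometry acting trivially on the residue field of `𝒪_w`), assume `W₀` is short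
(`a₁ = a₃ = 0`) and `σ(C) = ⟨−1, 0, 0, 0⟩ · C`. Then `red(Φ(P^σ)) = − red(Φ(P))` for every
`P ∈ X(L)`: the coordinates of `Φ(P^σ)` are `(σ x′, −σ y′) = −(σ x′, σ y′)` on the short model, and
`(σ x′, σ y′)` reduces like `(x′, y′)` (the tree's `reducePoint_some_eq_of_val`). The reduced change
of variables of Serre–Tate's descent datum is `[−1]` (cf. the tree's `exists_reducedAut_red_map_eq`).
[cite: SerreTate1968, §2 Thm. 2 (mechanism of proof)]
[cite: SilvermanAEC2009, VII.1 Prop. 1.3(d) and VII.2 Prop. 2.1] -/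
theorem goodReductionHom_pointEquiv_map_eq_neg_of_map_eq (X : WeierstrassCurve F)
    (C : VariableChange L) {W₀ : WeierstrassCurve w.integer}
    (hW₀ : C • X.baseChange L = W₀.baseChange L) (hΔ : IsUnit W₀.Δ) (σ : L ≃ₐ[F] L)
    (hσ : ∀ z, w (σ z) = w z) (hσI : ∀ z, w z ≤ 1 → w (σ z - z) < 1)
    (ha₁ : W₀.a₁ = 0) (ha₃ : W₀.a₃ = 0)
    (hC : C.map (σ : L →+* L) = (⟨-1, 0, 0, 0⟩ : VariableChange L) * C)
    (P : (X.baseChange L).toAffine.Point) :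
    goodReductionHom W₀ (Valuation.integer.integers w) hΔ
        (Affine.Point.congrEquiv hW₀ (VariableChange.pointEquiv (X.baseChange L) C
          (Affine.Point.map (σ : L →ₐ[F] L) P))) =
      - goodReductionHom W₀ (Valuation.integer.integers w) hΔ
        (Affine.Point.congrEquiv hW₀ (VariableChange.pointEquiv (X.baseChange L) C P)) := by
  -- adapted from p05's F-A1 `goodReductionHom_pointEquiv_map_eq_of_map_eq` (the `[+1]` case)
  set σr : L →+* L := (σ : L →+* L) with hσr
  have hXσ : (X.baseChange L).map σr = X.baseChange L := X.map_baseChange (σ : L →ₐ[F] L)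
  have keyX : ∀ x : L, C.toX (σ x) = σ (C.toX x) := fun x ↦ by
    change C.toX (σr x) = σr (C.toX x)
    rw [map_toX_ringHom, hC, toX_mul, toX_negOne]
  have keyY : ∀ x y : L, C.toY (σ x) (σ y) = - σ (C.toY x y) := fun x y ↦ by
    change C.toY (σr x) (σr y) = - σr (C.toY x y)
    rw [map_toY_ringHom, hC, toY_mul, toY_negOne, neg_neg]
  rcases P with _ | ⟨x, y, h⟩
  · simp only [← Affine.Point.zero_def, map_zero, neg_zero]
  have hσns : (X.baseChange L).toAffine.Nonsingular (σ x) (σ y) := by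
    have h1 : ((X.baseChange L).map σr).toAffine.Nonsingular (σ x) (σ y) :=
      (Affine.map_nonsingular _ σr.injective x y).mpr h
    rwa [hXσ] at h1
  have hmapP : Affine.Point.map (σ : L →ₐ[F] L) (.some x y h) = .some (σ x) (σ y) hσns := by
    rw [Affine.Point.map_some]
    exact point_some_congr rfl rfl
  rw [hmapP, VariableChange.pointEquiv_some, VariableChange.pointEquiv_some,
    Affine.Point.congrEquiv_some, Affine.Point.congrEquiv_some]
  set x' := C.toX x with hx'
  set y' := C.toY x y with hy'
  have hnsΦ : (W₀.baseChange L).toAffine.Nonsingular x' y' :=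
    hW₀ ▸ (VariableChange.nonsingular_iff (X.baseChange L) C x y).mpr h
  -- `(σ x', σ y')` is a point of `W₀ ⊗ L` (it is the NEGATIVE of `Φ(P^σ)`)
  have hnsΦσ : (W₀.baseChange L).toAffine.Nonsingular (C.toX (σ x)) (C.toY (σ x) (σ y)) :=
    hW₀ ▸ (VariableChange.nonsingular_iff (X.baseChange L) C (σ x) (σ y)).mpr hσns
  have ha₁L : (W₀.baseChange L).a₁ = 0 := by
    rw [WeierstrassCurve.baseChange, map_a₁, ha₁, map_zero]
  have ha₃L : (W₀.baseChange L).a₃ = 0 := by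
    rw [WeierstrassCurve.baseChange, map_a₃, ha₃, map_zero]
  have hnegY : ∀ X Y : L, (W₀.baseChange L).toAffine.negY X Y = -Y := fun X Y ↦ by
    rw [Affine.negY]
    change -Y - (W₀.baseChange L).a₁ * X - (W₀.baseChange L).a₃ = -Y
    rw [ha₁L, ha₃L, zero_mul, sub_zero, sub_zero]
  have hnsσ : (W₀.baseChange L).toAffine.Nonsingular (σ x') (σ y') := by
    have h1 := (Affine.nonsingular_neg _ _).mpr hnsΦσ
    rw [hnegY, keyX, keyY, neg_neg] at h1
    exact h1
  -- `Φ(P^σ) = −(σ x', σ y')`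
  have hneg : (Affine.Point.some (C.toX (σ x)) (C.toY (σ x) (σ y))
      (hW₀ ▸ (VariableChange.nonsingular_iff (X.baseChange L) C (σ x) (σ y)).mpr hσns) :
        (W₀.baseChange L).toAffine.Point) = - Affine.Point.some (σ x') (σ y') hnsσ := by
    rw [Affine.Point.neg_some]
    refine point_some_congr (keyX x) ?_
    rw [keyY, hnegY]
  rw [hneg, map_neg]
  congr 1
  simp only [goodReductionHom_apply]
  have e₂ : WeierstrassCurve.reducePoint W₀ (.some x' y'
      (hW₀ ▸ (VariableChange.nonsingular_iff (X.baseChange L) C x y).mpr h)) =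
      WeierstrassCurve.reducePoint W₀ (.some x' y' hnsΦ) := rfl
  rw [e₂]
  exact reducePoint_some_eq_of_val (W₀ := W₀) (hσ x') (hσI x') (hσI y')

end Valued

/-! ## §2 A Gauss sum in `K̄`: `s² = (−1/p)·p`, `τ s = (χ̄_p(τ)/p) s` -/

section Gauss

open Field Literature.NumberTheory.GaloisRepresentations

/-- **Gauss sum over any base field.** For a field `K` with `p ≠ 0` in `K`, `p` an odd prime: there
is `s ∈ K̄` (namely `∑_a (a/p) ζ_p^a`) with `s ≠ 0`, `s² = (−1/p) · p` (Mathlib `gaussSum_sq`), on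
which `Γ_K` acts through the Legendre symbol of the mod `p` cyclotomic character:
`τ s = (χ̄_p(τ)/p) s` (Mathlib `gaussSum_mulShift`). The tree's `Rat.exists_gaussSum` with the base
field generalised (same proof). [folklore] -/
theorem exists_gaussSum_algebraicClosure (K : Type*) [Field K] [CharZero K] {p : ℕ} [Fact p.Prime]
    [NeZero ((p : ℕ) : K)] (hp2 : p ≠ 2) :
    ∃ s : AlgebraicClosure K, s ≠ 0 ∧
      s ^ 2 = ((quadraticChar (ZMod p) (-1) : ℤ) : AlgebraicClosure K) * p ∧
      ∀ τ : absoluteGaloisGroup K,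
        τ • s = ((quadraticChar (ZMod p) (modNCyclotomicCharacter K p τ : ZMod p) : ℤ) :
          AlgebraicClosure K) * s := by
  -- adapted from the tree's `Rat.exists_gaussSum` (K = ℚ), same proof
  classical
  haveI : NeZero p := ⟨(Fact.out : p.Prime).ne_zero⟩
  haveI : CharZero (AlgebraicClosure K) :=
    charZero_of_injective_algebraMap (algebraMap K (AlgebraicClosure K)).injective
  obtain ⟨ζ, hζ⟩ := HasEnoughRootsOfUnity.exists_primitiveRoot (AlgebraicClosure K) p
  set ψ : AddChar (ZMod p) (AlgebraicClosure K) := AddChar.zmodChar p hζ.pow_eq_one with hψdef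
  set χ : MulChar (ZMod p) (AlgebraicClosure K) :=
    (quadraticChar (ZMod p)).ringHomComp (Int.castRingHom (AlgebraicClosure K)) with hχ
  have hpchar : ringChar (ZMod p) ≠ 2 := by rwa [ZMod.ringChar_zmod_n]
  have hχ1 : χ ≠ 1 :=
    (MulChar.ringHomComp_ne_one_iff (RingHom.injective_int _)).mpr (quadraticChar_ne_one hpchar)
  have hχ2 : χ.IsQuadratic := (quadraticChar_isQuadratic (ZMod p)).comp _
  have hψ : ψ.IsPrimitive := AddChar.zmodChar_primitive_of_primitive_root p hζ
  have hχapp : ∀ a : ZMod p, χ a = ((quadraticChar (ZMod p) a : ℤ) : AlgebraicClosure K) :=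
    fun a => rfl
  have hpK : ((p : ℕ) : AlgebraicClosure K) ≠ 0 := by
    rw [← map_natCast (algebraMap K (AlgebraicClosure K))]
    exact (map_ne_zero_iff _ (algebraMap K (AlgebraicClosure K)).injective).mpr (NeZero.ne _)
  refine ⟨gaussSum χ ψ, ?_, ?_, fun τ => ?_⟩
  · refine gaussSum_ne_zero_of_nontrivial ?_ hχ1 hψ
    rw [ZMod.card]
    exact hpK
  · rw [gaussSum_sq hχ1 hχ2 hψ, ZMod.card, hχapp]
  · -- `τ` acts on `s = ∑ χ(a) ζ^a` by `ζ ↦ ζ^n`, `n = χ_p(τ)`, giving the shifted Gauss sum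
    set u : (ZMod p)ˣ := modNCyclotomicCharacter K p τ with hu
    have hζτ : τ • ζ = ζ ^ (u : ZMod p).val := modNCyclotomicCharacter_spec K p τ ζ hζ.pow_eq_one
    have hshift : τ • gaussSum χ ψ = gaussSum χ (ψ.mulShift u) := by
      rw [absoluteGaloisGroup.smul_def, gaussSum, gaussSum, map_sum]
      refine Finset.sum_congr rfl fun a _ => ?_
      rw [map_mul, hχapp, map_intCast, AddChar.mulShift_apply, hψdef, AddChar.zmodChar_apply,
        AddChar.zmodChar_apply, map_pow, ← absoluteGaloisGroup.smul_def, hζτ, ← pow_mul,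
        ZMod.val_mul, ← pow_eq_pow_mod _ hζ.pow_eq_one]
    have hkey := gaussSum_mulShift χ ψ u
    rw [← hshift] at hkey
    have hsq : χ (u : ZMod p) * χ (u : ZMod p) = 1 := by
      rw [hχapp, ← Int.cast_mul, ← pow_two, quadraticChar_sq_one (Units.ne_zero u), Int.cast_one]
    calc τ • gaussSum χ ψ = (χ (u : ZMod p) * χ (u : ZMod p)) * (τ • gaussSum χ ψ) := by
          rw [hsq, one_mul]
      _ = χ (u : ZMod p) * gaussSum χ ψ := by rw [mul_assoc, hkey]
      _ = _ := by rw [hχapp]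

end Gauss

/-! ## §3 The SIGN of `σ^{e/2}` on the Kummer element: `σ^{e/2}(u) = (χ̄_p(σ)/p) · u` -/

section Local

open NumberField IsDedekindDomain Field IsDedekindDomain.HeightOneSpectrum
  Literature.NumberTheory.GaloisRepresentations
  Summit.BirchSwinnertonDyer.Rank1Residual.X2.GreenbergVatsalReductionDatum

variable (p : ℕ) [hp : Fact p.Prime] {v : HeightOneSpectrum (𝓞 ℚ)}

/-- **A fourth root of unity is fixed by the local inertia group at `v ∋ p`, `p` odd.** (`σ(i)/i` is
a fourth root of unity `≡ 1 (mod 𝔪)`; A1 `eq_one_of_pow_eq_one_of_specVal_sub_one_lt`.) [folklore] -/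
theorem smul_eq_self_of_pow_four_eq_one (hp2 : p ≠ 2) (hpv : ((p : ℕ) : 𝓞 ℚ) ∈ v.asIdeal)
    {i : AlgebraicClosure (v.adicCompletion ℚ)} (hi : i ^ 4 = 1)
    {σ : absoluteGaloisGroup (v.adicCompletion ℚ)} (hσ : σ ∈ absInertia (v.adicCompletion ℚ)) :
    σ • i = i := by
  obtain ⟨𝔐, h𝔐⟩ := v.localPrimesAbove_nonempty
  set ψ : AlgebraicClosure (v.adicCompletion ℚ) ≃ₐ[v.adicCompletion ℚ] AlgebraicClosure (v.adicCompletion ℚ) :=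
    absoluteGaloisGroup.toAlgEquiv _ σ with hψ
  have hσI' : σ ∈ 𝔐.inertia (absoluteGaloisGroup (v.adicCompletion ℚ)) := by
    rw [inertia_eq_absInertia (specVal_spec v) h𝔐]; exact hσ
  have hσI : ∀ z, specVal v z ≤ 1 → specVal v (ψ z - z) < 1 :=
    (mem_inertia_iff_spectralValuation (specVal_spec v) h𝔐).1 hσI'
  have h40 : (4 : ℕ) ≠ 0 := by norm_num
  have hwi : specVal v i = 1 := by
    have h : specVal v i ^ 4 = 1 := by rw [← map_pow, hi, map_one]
    exact (pow_eq_one_iff.mp h).resolve_right h40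
  have hi0 : i ≠ 0 := fun h ↦ by rw [h, zero_pow h40] at hi; exact zero_ne_one hi
  have hp4 : ¬ p ∣ 4 := by
    intro h
    have h' : p ∣ 2 ^ 2 := by norm_num; exact h
    exact hp2 ((Nat.prime_dvd_prime_iff_eq hp.out Nat.prime_two).mp (hp.out.dvd_of_dvd_pow h'))
  set η : AlgebraicClosure (v.adicCompletion ℚ) := ψ i * i⁻¹ with hη
  have hηe : η ^ 4 = 1 := by
    rw [hη, mul_pow, ← map_pow, hi, map_one, inv_pow, hi, inv_one, mul_one]
  have hη1 : specVal v (η - 1) < 1 := by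
    have h1 : η - 1 = (ψ i - i) * i⁻¹ := by rw [hη, sub_mul, mul_inv_cancel₀ hi0]
    rw [h1, map_mul, map_inv₀, hwi, inv_one, mul_one]
    exact hσI i hwi.le
  have hη' : η = 1 := eq_one_of_pow_eq_one_of_specVal_sub_one_lt p hpv h40 hηe hη1 hp4
  rw [absoluteGaloisGroup.smul_def, ← hψ]
  calc ψ i = η * i := by rw [hη, inv_mul_cancel_right₀ hi0]
    _ = i := by rw [hη', one_mul]

/-- **THE SIGN OF `σ^{e/2}` ON THE KUMMER ELEMENT.** At `v ∋ p`, `p` odd: for `σ` in the local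
inertia group and `u ∈ K̄_v` with `u^e = p^m`, `e` even, `p ∤ e`, `m` odd,
`σ^{e/2}(u) = (χ̄_p(σ)/p) · u`, `χ̄_p` the mod `p` cyclotomic character of `Γ_{ℚ_v}` and `(·/p)` the
Legendre symbol. Proof: `σ^k(u) = ζ^k u` with `ζ = σ(u)/u` fixed by `σ` (Q1
`exists_rootOfUnity_pow_smul_eq`), so `σ^{e/2}(u)/u = ζ^{e/2} = σ(t)/t` for `t := u^{e/2}`; and
`t² = p^m` gives `t = i · s^m` for the Gauss sum `s` (`s² = ±p`) and some `i` with `i^4 = 1`; inertia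
fixes `i` and multiplies `s` by `(χ̄_p(σ)/p)`, whose `m`-th power is itself (`m` odd). [folklore] -/
theorem pow_div_two_smul_eq_legendre_mul [NeZero ((p : ℕ) : v.adicCompletion ℚ)] (hp2 : p ≠ 2)
    (hpv : ((p : ℕ) : 𝓞 ℚ) ∈ v.asIdeal) {u : AlgebraicClosure (v.adicCompletion ℚ)} {e m : ℕ}
    (he0 : e ≠ 0) (h2e : 2 ∣ e) (hpe : ¬ p ∣ e) (hm : Odd m)
    (hu : u ^ e = (p : AlgebraicClosure (v.adicCompletion ℚ)) ^ m)
    {σ : absoluteGaloisGroup (v.adicCompletion ℚ)} (hσ : σ ∈ absInertia (v.adicCompletion ℚ)) :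
    (σ ^ (e / 2)) • u =
      ((quadraticChar (ZMod p) (modNCyclotomicCharacter (v.adicCompletion ℚ) p σ : ZMod p) : ℤ) :
        AlgebraicClosure (v.adicCompletion ℚ)) * u := by
  haveI : CharZero (AlgebraicClosure (v.adicCompletion ℚ)) :=
    charZero_of_injective_algebraMap (algebraMap ℚ (AlgebraicClosure (v.adicCompletion ℚ))).injective
  have hp0 : (p : AlgebraicClosure (v.adicCompletion ℚ)) ≠ 0 := Nat.cast_ne_zero.mpr hp.out.ne_zero
  have hu0 : u ≠ 0 := by
    intro h; rw [h, zero_pow he0] at hu; exact pow_ne_zero m hp0 hu.symm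
  obtain ⟨k, hk⟩ := h2e
  have hk2 : e / 2 = k := by rw [hk]; simp
  -- `ζ = σ u / u`, `σ^j u = ζ^j u`
  obtain ⟨ζ, hζe, -, hσζ, hiter⟩ := exists_rootOfUnity_pow_smul_eq p hpv he0 hpe hu hσ
  -- the sign `ε := (χ̄_p(σ)/p)` as an element of `L`, `ε = ±1`
  set c : ZMod p := (modNCyclotomicCharacter (v.adicCompletion ℚ) p σ : ZMod p) with hc
  set ε : AlgebraicClosure (v.adicCompletion ℚ) :=
    ((quadraticChar (ZMod p) c : ℤ) : AlgebraicClosure (v.adicCompletion ℚ)) with hε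
  -- the Gauss sum and `t = u^k`
  haveI : CharZero (v.adicCompletion ℚ) :=
    charZero_of_injective_algebraMap (algebraMap ℚ (v.adicCompletion ℚ)).injective
  obtain ⟨s, hs0, hs2, hsτ⟩ := exists_gaussSum_algebraicClosure (v.adicCompletion ℚ) (p := p) hp2
  set t : AlgebraicClosure (v.adicCompletion ℚ) := u ^ k with ht
  have ht2 : t ^ 2 = (p : AlgebraicClosure (v.adicCompletion ℚ)) ^ m := by
    rw [ht, ← pow_mul, mul_comm, ← hk, hu]
  -- `i := t / s^m` has `i^4 = 1`
  set δ : AlgebraicClosure (v.adicCompletion ℚ) :=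
    ((quadraticChar (ZMod p) (-1) : ℤ) : AlgebraicClosure (v.adicCompletion ℚ)) with hδ
  have hδsq : δ ^ 2 = 1 := by
    rw [hδ, ← Int.cast_pow, quadraticChar_sq_one (by
      rw [Ne, neg_eq_zero]; exact one_ne_zero), Int.cast_one]
  have hsm0 : s ^ m ≠ 0 := pow_ne_zero m hs0
  set i : AlgebraicClosure (v.adicCompletion ℚ) := t * (s ^ m)⁻¹ with hi
  have hi4 : i ^ 4 = 1 := by
    have h1 : (s ^ m) ^ 2 = δ ^ m * (p : AlgebraicClosure (v.adicCompletion ℚ)) ^ m := by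
      rw [← pow_mul, mul_comm, pow_mul, hs2, mul_pow]
    have h2 : i ^ 2 = δ ^ m := by
      rw [hi, mul_pow, inv_pow, ht2, h1, mul_inv, ← mul_assoc,
        mul_comm ((p : AlgebraicClosure (v.adicCompletion ℚ)) ^ m),
        mul_assoc, mul_inv_cancel₀ (pow_ne_zero m hp0), mul_one, ← inv_pow]
      have hδinv : δ⁻¹ = δ := inv_eq_of_mul_eq_one_right (by rw [← sq, hδsq])
      rw [hδinv]
    rw [show (4 : ℕ) = 2 * 2 by norm_num, pow_mul, h2, ← pow_mul, mul_comm, pow_mul, hδsq, one_pow]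
  have hti : t = i * s ^ m := by rw [hi, inv_mul_cancel_right₀ hsm0]
  -- inertia fixes `i` and multiplies `s^m` by `ε^m = ε`
  have hσi : σ • i = i := smul_eq_self_of_pow_four_eq_one p hp2 hpv hi4 hσ
  have hεm : ε ^ m = ε := by
    have hε2 : ε ^ 2 = 1 := by
      rw [hε, ← Int.cast_pow, quadraticChar_sq_one (Units.ne_zero _), Int.cast_one]
    obtain ⟨j, rfl⟩ := hm
    rw [pow_succ, pow_mul, hε2, one_pow, one_mul]
  have hσt : σ • t = ε * t := by
    rw [hti, smul_mul', hσi, smul_pow', hsτ σ, ← hε, mul_pow, hεm]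
    ring
  -- `σ t = ζ^k t` from `σ u = ζ u`
  have hσu : σ • u = ζ * u := by simpa using hiter 1
  have hσt' : σ • t = ζ ^ k * t := by rw [ht, smul_pow', hσu, mul_pow]
  have ht0 : t ≠ 0 := pow_ne_zero k hu0
  have hζk : ζ ^ k = ε := mul_right_cancel₀ ht0 (hσt'.symm.trans hσt)
  rw [hk2, hiter k, hζk]

end Local

end Summit.BirchSwinnertonDyer.Rank1Residual.Additive.GoodModelLine

end
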